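import Summits.NavierStokesRegularity.NavierStokesRegularity.Theorems.IsotropicBlobWitnessField
import HarnessLib

/-!
# THE `C²` WITNESS FIELD of ROUND-41 — the derivative on the open ball and outside (plate (V), part V5;
LEAD S-door ns-s30-p1 g4 PLATE MAP v2; texts nsreg-p1 g33 `r41/Sketch45.lean`; defs `Theorems/IsotropicBlobDefs.lean`)

Cell `ns-regularity-ideate`, seat ns-sfl-p1 g6, `--supports stmt-NavierStokesRegularity-0056 --as helper`.
With `s = ‖x‖²`, `S = uniaxialS`, `q(x) = ⟪x, Sx⟫`, envelopes `a(s) = (1−s)³(1−11s/3)`, `a′(s) = −3(1−s)²(1−11s/3) − (11/3)(1−s)³`,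
`b(s) = (8/3)(1−s)³`, `b′(s) = −8(1−s)²`, the witness is `u = a(s)•Sx + (b(s) q)•x` on the open ball (V1):

* `hasFDerivAt_witnessFieldC2_of_lt` — for `‖x‖² < 1`:
  `Du(x) v = a(s)•Sv + (2a′(s)⟪x,v⟫)•Sx + (b(s)q(x))•v + (2b′(s)⟪x,v⟫ q(x) + 2b(s)⟪Sx,v⟫)•x`
  (as the continuous linear map `witnessDeriv x`-free explicit sum of `smulRight`s); `fderiv_witnessFieldC2_apply_of_lt`;
* `fderiv_witnessFieldC2_of_gt` — `Du(x) = 0` for `‖x‖² > 1`;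
* (V6) `inner_fderiv_witnessFieldC2_of_lt` — the strain form `⟪Du(y)e, e⟫` on the open ball as an explicit polynomial:
  `a⟪Se,e⟫ + 2a′⟪y,e⟫⟪Sy,e⟫ + b q ‖e‖² + (2b′ q ⟪y,e⟫ + 2b⟪Sy,e⟫)⟪y,e⟫`.

HONEST FRAMING: kinematic slice witness; item 0056 `NoTypeII` and NS regularity NOT proved; no summit statement is proved
by this seat.
-/

noncomputable section

open MeasureTheory Set Function Filter Metric Real InnerProductSpace
open _root_.Topology
open scoped ENNReal NNReal RealInnerProductSpace ContDiff Laplacian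
open Literature.Analysis Literature.Analysis.FluidPDE VectorCalculus

namespace Summit.NavierStokesRegularity.NavierStokesRegularity.Theorems.StrainDoors.IsotropicBlob

open Summit.NavierStokesRegularity.NavierStokesRegularity.Theorems.ArgmaxDoors
open Summit.NavierStokesRegularity.NavierStokesRegularity.Theorems.StrainDoors

set_option linter.dupNamespace false

/-- `uniaxialS` is symmetric: `⟪Sx, y⟫ = ⟪x, Sy⟫`. -/
theorem uniaxialS_symm (x y : E3) : ⟪uniaxialS x, y⟫ = ⟪x, uniaxialS y⟫ := by
  obtain ⟨h0, h1, h2⟩ := uniaxialS_apply x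
  obtain ⟨k0, k1, k2⟩ := uniaxialS_apply y
  rw [EuclideanSpace.inner_eq_star_dotProduct, EuclideanSpace.inner_eq_star_dotProduct, dotProduct, dotProduct,
    Fin.sum_univ_three, Fin.sum_univ_three]
  simp only [star_trivial]
  change y 0 * uniaxialS x 0 + y 1 * uniaxialS x 1 + y 2 * uniaxialS x 2 =
    uniaxialS y 0 * x 0 + uniaxialS y 1 * x 1 + uniaxialS y 2 * x 2
  rw [h0, h1, h2, k0, k1, k2]
  ring

/-- Derivative of the quadratic form `q(x) = ⟪x, Sx⟫`: `Dq(x) v = 2⟪Sx, v⟫`. -/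
theorem hasFDerivAt_inner_uniaxialS (x : E3) :
    HasFDerivAt (fun y : E3 => ⟪y, uniaxialS y⟫) ((2 : ℝ) • innerSL ℝ (uniaxialS x)) x := by
  have h : HasFDerivAt (fun y : E3 => ⟪y, uniaxialS y⟫)
      ((fderivInnerCLM ℝ (x, uniaxialS x)).comp ((ContinuousLinearMap.id ℝ E3).prod uniaxialS)) x :=
    (hasFDerivAt_id x).inner ℝ uniaxialS.hasFDerivAt
  refine h.congr_fderiv ?_
  ext v
  simp only [ContinuousLinearMap.comp_apply, ContinuousLinearMap.prod_apply, fderivInnerCLM_apply,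
    ContinuousLinearMap.id_apply, _root_.smul_apply, innerSL_apply_apply, smul_eq_mul]
  rw [← uniaxialS_symm x v, real_inner_comm (uniaxialS x) v]
  ring

/-- Derivative of `‖x‖²`: `2⟪x, v⟫` (real scalar form). -/
theorem hasFDerivAt_norm_sq' (x : E3) : HasFDerivAt (fun y : E3 => ‖y‖ ^ 2) ((2 : ℝ) • innerSL ℝ x) x :=
  (hasStrictFDerivAt_norm_sq x).hasFDerivAt.congr_fderiv (by simp only [two_smul])

/-- `d/ds [(1−s)³(1−11s/3)] = −3(1−s)²(1−11s/3) − (11/3)(1−s)³`. -/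
theorem hasDerivAt_envelopeA (s : ℝ) :
    HasDerivAt (fun s : ℝ => (1 - s) ^ 3 * (1 - 11 * s / 3))
      (-3 * (1 - s) ^ 2 * (1 - 11 * s / 3) - 11 / 3 * (1 - s) ^ 3) s := by
  have h1 : HasDerivAt (fun s : ℝ => (1 - s) ^ 3) (-3 * (1 - s) ^ 2) s :=
    (((hasDerivAt_id s).const_sub 1).pow 3).congr_deriv (by norm_num)
  have h2 : HasDerivAt (fun s : ℝ => 1 - 11 * s / 3) (-(11 / 3)) s :=
    ((((hasDerivAt_id s).const_mul 11).div_const 3).const_sub 1).congr_deriv (by norm_num)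
  exact (h1.mul h2).congr_deriv (by ring)

/-- `d/ds [(8/3)(1−s)³] = −8(1−s)²`. -/
theorem hasDerivAt_envelopeB (s : ℝ) :
    HasDerivAt (fun s : ℝ => 8 / 3 * (1 - s) ^ 3) (-8 * (1 - s) ^ 2) s := by
  have h1 : HasDerivAt (fun s : ℝ => (1 - s) ^ 3) (-3 * (1 - s) ^ 2) s :=
    (((hasDerivAt_id s).const_sub 1).pow 3).congr_deriv (by norm_num)
  exact (h1.const_mul (8 / 3)).congr_deriv (by ring)

/-- **(V5) THE DERIVATIVE ON THE OPEN BALL.**  For `‖x‖² < 1`, with `s = ‖x‖²`, `a = (1−s)³(1−11s/3)`,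
`a′ = −3(1−s)²(1−11s/3) − (11/3)(1−s)³`, `b = (8/3)(1−s)³`, `b′ = −8(1−s)²`, `q = ⟪x,Sx⟫`:
`Du(x) = a•S + (2a′)•⟪x,·⟫⊗Sx + (bq)•id + ⟪(2b′q)•x + (2b)•Sx, ·⟫⊗x`. -/
theorem hasFDerivAt_witnessFieldC2_of_lt {x : E3} (hx : ‖x‖ ^ 2 < 1) :
    HasFDerivAt witnessFieldC2
      (((1 - ‖x‖ ^ 2) ^ 3 * (1 - 11 * ‖x‖ ^ 2 / 3)) • uniaxialS +
        ((2 * (-3 * (1 - ‖x‖ ^ 2) ^ 2 * (1 - 11 * ‖x‖ ^ 2 / 3) - 11 / 3 * (1 - ‖x‖ ^ 2) ^ 3)) • innerSL ℝ x).smulRight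
          (uniaxialS x) +
        (8 / 3 * (1 - ‖x‖ ^ 2) ^ 3 * ⟪x, uniaxialS x⟫) • ContinuousLinearMap.id ℝ E3 +
        (innerSL ℝ ((2 * (-8 * (1 - ‖x‖ ^ 2) ^ 2) * ⟪x, uniaxialS x⟫) • x +
          (2 * (8 / 3 * (1 - ‖x‖ ^ 2) ^ 3)) • uniaxialS x)).smulRight x) x := by
  -- the (V1) expression near `x`
  have hopen : IsOpen {y : E3 | ‖y‖ ^ 2 < 1} := isOpen_lt (continuous_norm.pow 2) continuous_const
  have hev : witnessFieldC2 =ᶠ[𝓝 x] fun y =>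
      ((1 - ‖y‖ ^ 2) ^ 3 * (1 - 11 * ‖y‖ ^ 2 / 3)) • uniaxialS y + (8 / 3 * (1 - ‖y‖ ^ 2) ^ 3 * ⟪y, uniaxialS y⟫) • y :=
    Filter.eventually_of_mem (hopen.mem_nhds hx) fun y hy => witnessFieldC2_eq_of_lt hy
  -- envelopes as functions of `s`, composed with `‖·‖²`
  have hs := hasFDerivAt_norm_sq' x
  have ha : HasFDerivAt (fun y : E3 => (1 - ‖y‖ ^ 2) ^ 3 * (1 - 11 * ‖y‖ ^ 2 / 3))
      ((-3 * (1 - ‖x‖ ^ 2) ^ 2 * (1 - 11 * ‖x‖ ^ 2 / 3) - 11 / 3 * (1 - ‖x‖ ^ 2) ^ 3) • ((2 : ℝ) • innerSL ℝ x)) x := by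
    have h := (hasDerivAt_envelopeA (‖x‖ ^ 2)).comp_hasFDerivAt x hs
    exact h
  have hb : HasFDerivAt (fun y : E3 => 8 / 3 * (1 - ‖y‖ ^ 2) ^ 3)
      ((-8 * (1 - ‖x‖ ^ 2) ^ 2) • ((2 : ℝ) • innerSL ℝ x)) x := by
    have h := (hasDerivAt_envelopeB (‖x‖ ^ 2)).comp_hasFDerivAt x hs
    exact h
  have hq := hasFDerivAt_inner_uniaxialS x
  have hc := hb.mul hq
  have hS : HasFDerivAt (fun y : E3 => uniaxialS y) uniaxialS x := uniaxialS.hasFDerivAt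
  have hid : HasFDerivAt (fun y : E3 => y) (ContinuousLinearMap.id ℝ E3) x := hasFDerivAt_id x
  have h := (ha.smul hS).add (hc.smul hid)
  refine (h.congr_of_eventuallyEq hev).congr_fderiv ?_
  ext v i
  simp only [_root_.add_apply, _root_.smul_apply, ContinuousLinearMap.smulRight_apply, innerSL_apply_apply,
    ContinuousLinearMap.id_apply, smul_eq_mul, Pi.mul_apply, PiLp.add_apply, PiLp.smul_apply, inner_add_left,
    real_inner_smul_left]
  ring

/-- **(V5) THE DERIVATIVE VANISHES OUTSIDE THE CLOSED BALL**: `Du(x) = 0` for `‖x‖² > 1`. -/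
theorem fderiv_witnessFieldC2_of_gt {x : E3} (hx : 1 < ‖x‖ ^ 2) : fderiv ℝ witnessFieldC2 x = 0 := by
  have hopen : IsOpen {y : E3 | 1 < ‖y‖ ^ 2} := isOpen_lt continuous_const (continuous_norm.pow 2)
  have hev : witnessFieldC2 =ᶠ[𝓝 x] fun _ => (0 : E3) :=
    Filter.eventually_of_mem (hopen.mem_nhds hx) fun y hy => witnessFieldC2_eq_zero_of_le (le_of_lt hy)
  rw [hev.fderiv_eq]
  exact fderiv_const_apply 0

/-- **(V6) THE STRAIN FORM ON THE OPEN BALL**: for `‖y‖² < 1` and any `e`,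
`⟪Du(y)e, e⟫ = a⟪Se,e⟫ + 2a′⟪y,e⟫⟪Sy,e⟫ + b q ‖e‖² + (2b′ q ⟪y,e⟫ + 2b ⟪Sy,e⟫)⟪y,e⟫`
(`s = ‖y‖²`, `a, a′, b, b′, q` as in `hasFDerivAt_witnessFieldC2_of_lt`). -/
theorem inner_fderiv_witnessFieldC2_of_lt {y : E3} (hy : ‖y‖ ^ 2 < 1) (e : E3) :
    ⟪fderiv ℝ witnessFieldC2 y e, e⟫ =
      (1 - ‖y‖ ^ 2) ^ 3 * (1 - 11 * ‖y‖ ^ 2 / 3) * ⟪uniaxialS e, e⟫ +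
        2 * (-3 * (1 - ‖y‖ ^ 2) ^ 2 * (1 - 11 * ‖y‖ ^ 2 / 3) - 11 / 3 * (1 - ‖y‖ ^ 2) ^ 3) * ⟪y, e⟫ * ⟪uniaxialS y, e⟫ +
        8 / 3 * (1 - ‖y‖ ^ 2) ^ 3 * ⟪y, uniaxialS y⟫ * ‖e‖ ^ 2 +
        (2 * (-8 * (1 - ‖y‖ ^ 2) ^ 2) * ⟪y, uniaxialS y⟫ * ⟪y, e⟫ + 2 * (8 / 3 * (1 - ‖y‖ ^ 2) ^ 3) * ⟪uniaxialS y, e⟫) *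
          ⟪y, e⟫ := by
  rw [(hasFDerivAt_witnessFieldC2_of_lt hy).fderiv]
  simp only [_root_.add_apply, _root_.smul_apply, ContinuousLinearMap.smulRight_apply, innerSL_apply_apply,
    ContinuousLinearMap.id_apply, inner_add_left, real_inner_smul_left, real_inner_self_eq_norm_sq, smul_eq_mul]

end Summit.NavierStokesRegularity.NavierStokesRegularity.Theorems.StrainDoors.IsotropicBlob

end
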